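import Mathlib
import HarnessLib
import Summits.CriticalPhenomena.PercolationContinuityZ3.Theses.PercTreeValue
import Literature.Probability.Percolation.ClusterBoundary

/-!
# `stub_markov` of line `SketchIdeator2` (crux `TetrahedronDisjointCoexistence`,
# stmt-CriticalPhenomena-7798): the Markov / cluster-exploration lower bound

Registered stub `stub_markov` (S4, off-path) of the lead's skeleton
`Cruxes/TetrahedronDisjointCoexistence/Lines/SketchIdeator2.lean`, landed DEF-FREE over tree
declarations.

For Bernoulli bond percolation `P = bondPercolation G p` on any graph `G` with countably many
vertices, any `p`, and vertices `o a b c`: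

`Σ'_S 𝟙{a ∈ S, b ∉ S, c ∉ S} · P(K_o = S) · P(b ↔ c off S) ≤ P(o ↔ a, b ↔ c, o ↮ b)`,

the sum running over finite vertex sets `S` (`K_o = openCluster ω o`, `{K_o = S} = clusterIs o S`,
`{b ↔ c off S} = openConnIn (↑S)ᶜ b c`).

Proof. For each `S` with `a ∈ S`, `b ∉ S` the event `{K_o = S} ∩ {b ↔ c off S}` lies in the
disjoint-coexistence event `D = {o ↔ a} ∩ {b ↔ c} ∩ {o ↔ b}ᶜ` (`a ∈ S = K_o`, `b ∉ S = K_o`, and a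
connection off `S` is a connection), its probability factorises
(`real_clusterIs_inter_offConn`: the two events are determined by the disjoint edge sets "edges
touching `S`" and "pairs inside `Sᶜ`"), and these events are pairwise disjoint in `S`
(`pairwise_disjoint_clusterIs`). Hence every finite partial sum is the probability of a finite
disjoint union contained in `D` (`measureReal_biUnion_finset`, `measureReal_mono`), and
`Real.tsum_le_of_sum_le` concludes (no summability bookkeeping is needed).
-/

noncomputable section

namespace Summit.CriticalPhenomena.PercolationContinuityZ3.Theorems.TetrahedronDisjointCoexistence

open MeasureTheory
open Literature.Probability.Percolation Literature.Probability.LatticeModels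

/-- Pointwise heart of the Markov bound: if `K_o = S` with `a ∈ S`, `b ∉ S`, and `b ↔ c` off
`S`, then `o ↔ a`, `b ↔ c` and `o ↮ b`. -/
theorem markov_clusterIs_inter_offConn_subset {V : Type*} {o a b c : V} {S : Finset V}
    (ha : a ∈ S) (hb : b ∉ S) :
    clusterIs o S ∩ openConnIn ((↑S : Set V)ᶜ) b c ⊆
      openConn o a ∩ openConn b c ∩ (openConn o b)ᶜ := by
  rintro ω ⟨hK, hoff⟩
  rw [mem_clusterIs] at hK
  refine ⟨⟨?_, openConnIn_subset_openConn _ b c hoff⟩, ?_⟩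
  · -- `a ∈ S = K_o`, i.e. `o ↔ a`
    have h : a ∈ openCluster ω o := by
      rw [hK]
      exact_mod_cast ha
    exact h
  · -- `b ∉ S = K_o`, i.e. `o ↮ b`
    intro h
    have h' : b ∈ openCluster ω o := h
    rw [hK] at h'
    exact hb (by exact_mod_cast h')

/-- Countable additivity in inequality form, over `ℝ`: if the measurable sets `g i` are pairwise
disjoint and all contained in `D`, then `Σ'_i μ(g i) ≤ μ(D)` for a finite measure `μ` (every finite
partial sum is the measure of a finite disjoint union inside `D`). -/
theorem markov_tsum_measureReal_le_of_pairwise_disjoint {ι Ω : Type*} [MeasurableSpace Ω]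
    (μ : Measure Ω) [IsFiniteMeasure μ] (g : ι → Set Ω) (D : Set Ω) (hsub : ∀ i, g i ⊆ D)
    (hm : ∀ i, MeasurableSet (g i)) (hdisj : Pairwise (Function.onFun Disjoint g)) :
    ∑' i, μ.real (g i) ≤ μ.real D := by
  refine Real.tsum_le_of_sum_le (fun _ => measureReal_nonneg) fun T => ?_
  rw [← measureReal_biUnion_finset (hdisj.set_pairwise _) (fun i _ => hm i)]
  exact measureReal_mono (Set.iUnion₂_subset fun i _ => hsub i)

/-- **S4 — Markov lower bound (form (M)).** For `P = bondPercolation G p` on a graph with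
countably many vertices and vertices `o a b c`:
`Σ'_S 𝟙{a ∈ S, b ∉ S, c ∉ S} P(K_o = S) P(b ↔ c off S) ≤ P(o ↔ a, b ↔ c, o ↮ b)`.
For finite `S ∋ a` with `b, c ∉ S`: `{K_o = S} ∩ {b ↔ c off S} ⊆ {o ↔ a, b ↔ c, o ↮ b}`
(`markov_clusterIs_inter_offConn_subset`), these events are pairwise disjoint in `S`
(`pairwise_disjoint_clusterIs`) and each factorises (`real_clusterIs_inter_offConn`, disjoint edge
supports); sum the finite partial sums (`Real.tsum_le_of_sum_le`). -/
theorem stub_markov {V : Type*} [Countable V] [DecidableEq V] (G : SimpleGraph V) (p : unitInterval) (o a b c : V) :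
    ∑' S : Finset V,
        (if a ∈ S ∧ b ∉ S ∧ c ∉ S then
          (bondPercolation G p).real (clusterIs o S) *
            (bondPercolation G p).real (openConnIn ((↑S : Set V)ᶜ) b c)
         else 0) ≤
      (bondPercolation G p).real (openConn o a ∩ openConn b c ∩ (openConn o b)ᶜ) := by
  -- the pieces of the disjoint union
  let g : Finset V → Set (BondConfig V) := fun S =>
    if a ∈ S ∧ b ∉ S ∧ c ∉ S then clusterIs o S ∩ openConnIn ((↑S : Set V)ᶜ) b c else ∅
  have hterm : ∀ S : Finset V,
      (if a ∈ S ∧ b ∉ S ∧ c ∉ S then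
          (bondPercolation G p).real (clusterIs o S) *
            (bondPercolation G p).real (openConnIn ((↑S : Set V)ᶜ) b c)
        else 0) = (bondPercolation G p).real (g S) := by
    intro S
    by_cases h : a ∈ S ∧ b ∉ S ∧ c ∉ S
    · simp only [g, if_pos h]
      exact (real_clusterIs_inter_offConn G p o S b c).symm
    · simp only [g, if_neg h, measureReal_empty]
  refine (tsum_congr hterm).trans_le
    (markov_tsum_measureReal_le_of_pairwise_disjoint _ g _ (fun S => ?_) (fun S => ?_)
      fun S T hST => ?_)
  · -- inclusion in the disjoint-coexistence event
    by_cases h : a ∈ S ∧ b ∉ S ∧ c ∉ S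
    · simp only [g, if_pos h]
      exact markov_clusterIs_inter_offConn_subset h.1 h.2.1
    · simp only [g, if_neg h]
      exact Set.empty_subset _
  · -- measurability
    by_cases h : a ∈ S ∧ b ∉ S ∧ c ∉ S
    · simp only [g, if_pos h]
      exact (measurableSet_clusterIs o S).inter (measurableSet_offConn S b c)
    · simp only [g, if_neg h]
      exact MeasurableSet.empty
  · -- pairwise disjointness (the values of the cluster are disjoint events)
    by_cases hS : a ∈ S ∧ b ∉ S ∧ c ∉ S
    · by_cases hT : a ∈ T ∧ b ∉ T ∧ c ∉ T
      · simp only [Function.onFun, g, if_pos hS, if_pos hT]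
        exact Disjoint.mono Set.inter_subset_left Set.inter_subset_left
          (pairwise_disjoint_clusterIs o hST)
      · simp only [Function.onFun, g, if_neg hT]
        exact Set.disjoint_empty _
    · simp only [Function.onFun, g, if_neg hS]
      exact Set.empty_disjoint _

end Summit.CriticalPhenomena.PercolationContinuityZ3.Theorems.TetrahedronDisjointCoexistence

end
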